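import Mathlib
import Summits.NavierStokesRegularity.NavierStokesRegularity.Theorems.EulerZoomLiouvillePowerGaugeEulerLiouvilleNeedleStagnationKinematics

/-!
# Crux `EulerZoomLiouville.PowerGaugeEulerLiouville` (stmt-NavierStokesRegularity-19832), THE ONE STATEMENT `stub_selfSimilarC2Needle`:
# NON-VORTICAL STAGNATION POINTS INTERTWINE — at `z` with `W(z) = 0` and `Ω(z) = 0` the vorticity gradient `X := DΩ(z)` satisfies
# `X ∘ DW(z) = (DW(z) − (1+γ)) ∘ X`, i.e. `[DW(z), X] = (1+γ)·X`: `X` RAISES eigenvalues of `DW(z)` by exactly `1 + γ`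

ROUND-41 (nsreg-p2 g33) (N6).  Source: the vorticity profile equation `DΩ·W − DU·Ω = −Ω` (`IsSelfSimilarEulerProfile.vorticity_eq_sub_form`)
differentiated at a common zero of `W` and `Ω`; only `U ∈ C²` is needed (the term `D²Ω·W` never appears because `W(z) = 0`, and `D²U·Ω` vanishes
because `Ω(z) = 0`).  Consequence (text): since `tr DW = 3γ < 1 + γ` for `γ < 1/2`, a node all of whose eigenvalues have real part in `]0, 3γ[`
(a backward-ATTRACTING node, the only kind that can absorb an open set of labels) admits no pair of eigenvalues differing by `1+γ`, hence
`DΩ(z) = 0`: vorticity vanishes to SECOND order at every such node.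

WHAT THIS IS NOT: not NS, not E — kinematics for THE ONE STATEMENT; 19832 is OPEN.  [folklore-level consequence of the profile equation]
-/

noncomputable section

set_option linter.dupNamespace false

open Set Metric Function InnerProductSpace Filter Asymptotics
open scoped RealInnerProductSpace Topology

namespace Summit.NavierStokesRegularity.NavierStokesRegularity.Theorems.PowerGaugeEulerLiouville.Stagnation

open Literature.Analysis Literature.Analysis.FluidPDE

variable {γ : ℝ} {U : (EuclideanSpace ℝ (Fin 3)) → (EuclideanSpace ℝ (Fin 3))} {P : (EuclideanSpace ℝ (Fin 3)) → ℝ}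

/-- Product rule at a zero: if `f` is merely CONTINUOUS at `z` (operator-valued) and `g` is differentiable at `z` with `g z = 0`, then
`y ↦ f y (g y)` is differentiable at `z` with derivative `f z ∘ g'`. [folklore] -/
theorem hasFDerivAt_clm_apply_of_eq_zero {E : Type*} [NormedAddCommGroup E] [NormedSpace ℝ E]
    {f : E → E →L[ℝ] E} {g : E → E} {g' : E →L[ℝ] E} {z : E}
    (hf : ContinuousAt f z) (hg : HasFDerivAt g g' z) (hz : g z = 0) :
    HasFDerivAt (fun y => f y (g y)) ((f z).comp g') z := by
  -- split `f y (g y) = f z (g y) + (f y - f z) (g y)`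
  have h1 : HasFDerivAt (fun y => f z (g y)) ((f z).comp g') z := (f z).hasFDerivAt.comp z hg
  have h2 : HasFDerivAt (fun y => (f y - f z) (g y)) (0 : E →L[ℝ] E) z := by
    rw [hasFDerivAt_iff_isLittleO_nhds_zero]
    have h' : Tendsto (fun h : E => z + h) (𝓝 0) (𝓝 z) := by
      simpa using (tendsto_const_nhds.add tendsto_id : Tendsto (fun h : E => z + h) (𝓝 0) (𝓝 (z + 0)))
    have hf0 : Tendsto (fun h : E => f (z + h) - f z) (𝓝 0) (𝓝 0) := by
      simpa using (hf.tendsto.comp h').sub_const (f z)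
    have hfo : (fun h : E => ‖f (z + h) - f z‖) =o[𝓝 0] (fun _ => (1 : ℝ)) := by
      rw [isLittleO_one_iff]
      simpa using hf0.norm
    have hgO : (fun h : E => g (z + h)) =O[𝓝 0] (fun h => h) := by
      have := hg.isBigO_sub.comp_tendsto h'
      simpa [Function.comp_def, hz] using this
    have hm : (fun h : E => ‖f (z + h) - f z‖ * ‖g (z + h)‖) =o[𝓝 0] (fun h => (1 : ℝ) * ‖h‖) :=
      hfo.mul_isBigO hgO.norm_norm
    have hF : (fun h : E => (f (z + h) - f z) (g (z + h))) =O[𝓝 0]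
        (fun h => ‖f (z + h) - f z‖ * ‖g (z + h)‖) :=
      IsBigO.of_bound 1 (Eventually.of_forall fun h => by
        rw [one_mul, Real.norm_of_nonneg (by positivity)]
        exact ContinuousLinearMap.le_opNorm _ _)
    have hlo : (fun h : E => (f (z + h) - f z) (g (z + h))) =o[𝓝 0] (fun h => h) := by
      have := hF.trans_isLittleO hm
      simp only [one_mul] at this
      exact this.of_norm_right
    refine hlo.congr' (Eventually.of_forall fun h => ?_) EventuallyEq.rfl
    simp [hz]
  have h := h1.add h2
  simp only [add_zero] at h
  refine h.congr_of_eventuallyEq (Eventually.of_forall fun y => ?_)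
  simp only [Pi.add_apply, _root_.sub_apply]
  abel

/-- **NON-VORTICAL STAGNATION POINTS INTERTWINE.**  At `z` with `W(z) = 0` and `Ω(z) = 0` (`W = γy + U`, `Ω = curl U`), for every `h`:
`DΩ(z)(DW(z) h) = DW(z)(DΩ(z) h) − (1+γ)·DΩ(z) h`, i.e. `[DW(z), DΩ(z)] = (1+γ)·DΩ(z)`.  Proof: both sides of the vorticity profile equation
`DΩ·W = DU·Ω − Ω` are differentiable at `z` — the left because `W(z) = 0` (product rule at a zero, `DΩ` only continuous), the right because `U ∈ C²` —
and `D²U(z)[·]Ω(z) = 0`. -/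
theorem fderiv_curl_intertwine_of_stagnation (hprof : IsSelfSimilarEulerProfile γ 0 U P) {z : EuclideanSpace ℝ (Fin 3)}
    (hz : selfSimilarTransport γ 0 U z = 0) (hΩ : curl U z = 0) (h : EuclideanSpace ℝ (Fin 3)) :
    fderiv ℝ (curl U) z (fderiv ℝ (selfSimilarTransport γ 0 U) z h) =
      fderiv ℝ (selfSimilarTransport γ 0 U) z (fderiv ℝ (curl U) z h) - (1 + γ) • fderiv ℝ (curl U) z h := by
  have hU2 : ContDiff ℝ 2 U := hprof.contDiff_velocity
  have hΩ1 : ContDiff ℝ 1 (curl U) := contDiff_curl (n := 1) (by simpa [one_add_one_eq_two] using hU2)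
  have hUd : Differentiable ℝ U := hU2.differentiable (by norm_num)
  have hΩd : Differentiable ℝ (curl U) := hΩ1.differentiable (by norm_num)
  have hDUc : ContDiff ℝ 1 (fderiv ℝ U) := hU2.fderiv_right (m := 1) (by norm_num)
  -- the two sides of the vorticity equation as functions of `y`
  set F : EuclideanSpace ℝ (Fin 3) → EuclideanSpace ℝ (Fin 3) := fun y => fderiv ℝ (curl U) y (selfSimilarTransport γ 0 U y)
    with hF
  have hFG : F = fun y => fderiv ℝ U y (curl U y) - curl U y := by
    funext y
    have hv := hprof.vorticity_eq_sub_form y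
    rw [hF]
    simp only [selfSimilarTransport_apply]
    rw [sub_eq_iff_eq_add] at hv
    rw [hv]
    abel
  -- derivative of the left side at `z` (product rule at the zero `W z = 0`)
  have hW : HasFDerivAt (selfSimilarTransport γ 0 U) (fderiv ℝ (selfSimilarTransport γ 0 U) z) z :=
    (hasFDerivAt_selfSimilarTransport (γ := γ) (hUd z)).differentiableAt.hasFDerivAt
  have hL : HasFDerivAt F ((fderiv ℝ (curl U) z).comp (fderiv ℝ (selfSimilarTransport γ 0 U) z)) z :=
    hasFDerivAt_clm_apply_of_eq_zero ((hΩ1.continuous_fderiv (by norm_num)).continuousAt) hW hz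
  -- derivative of the right side at `z`
  have hc : HasFDerivAt (fderiv ℝ U) (fderiv ℝ (fderiv ℝ U) z) z := (hDUc.differentiable (by norm_num) z).hasFDerivAt
  have hu : HasFDerivAt (curl U) (fderiv ℝ (curl U) z) z := (hΩd z).hasFDerivAt
  have hR : HasFDerivAt (fun y => fderiv ℝ U y (curl U y) - curl U y)
      ((fderiv ℝ U z).comp (fderiv ℝ (curl U) z) + (fderiv ℝ (fderiv ℝ U) z).flip (curl U z) - fderiv ℝ (curl U) z) z :=
    (hc.clm_apply hu).sub hu
  rw [← hFG] at hR
  have huniq := hL.unique hR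
  -- evaluate at `h`
  have happ := congrArg (fun L : EuclideanSpace ℝ (Fin 3) →L[ℝ] EuclideanSpace ℝ (Fin 3) => L h) huniq
  simp only [ContinuousLinearMap.comp_apply, _root_.sub_apply, hΩ, map_zero, add_zero] at happ
  rw [happ, fderiv_selfSimilarTransport (γ := γ) (hUd z), _root_.add_apply, _root_.smul_apply,
    ContinuousLinearMap.id_apply, add_smul, one_smul]
  abel

/-- **RAISING.**  At a non-vortical stagnation point, `DΩ(z)` maps an eigenvector of `DW(z)` with eigenvalue `μ` to an eigenvector with eigenvalue
`μ + 1 + γ` (or to `0`): `DW(z)(DΩ(z) v) = (μ + 1 + γ)·DΩ(z) v`.  Since `tr DW = 3γ < 1 + γ` for `γ < 1/2`, chains are short: `DΩ(z)` is nilpotent, and it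
VANISHES whenever no two eigenvalues of `DW(z)` differ by exactly `1 + γ` (text). -/
theorem fderiv_transport_apply_fderiv_curl_of_eigen (hprof : IsSelfSimilarEulerProfile γ 0 U P) {z : EuclideanSpace ℝ (Fin 3)}
    (hz : selfSimilarTransport γ 0 U z = 0) (hΩ : curl U z = 0) {v : EuclideanSpace ℝ (Fin 3)} {μ : ℝ}
    (hv : fderiv ℝ (selfSimilarTransport γ 0 U) z v = μ • v) :
    fderiv ℝ (selfSimilarTransport γ 0 U) z (fderiv ℝ (curl U) z v) = (μ + 1 + γ) • fderiv ℝ (curl U) z v := by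
  have h := fderiv_curl_intertwine_of_stagnation hprof hz hΩ v
  rw [hv, map_smul] at h
  have h2 := (eq_sub_iff_add_eq.mp h).symm
  rw [h2]
  simp only [add_smul, one_smul]
  abel

end Summit.NavierStokesRegularity.NavierStokesRegularity.Theorems.PowerGaugeEulerLiouville.Stagnation
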